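import Mathlib.NumberTheory.NumberField.InfinitePlace.TotallyRealComplex
import Literature.NumberTheory.EllipticCurves.HeegnerPointsImaginaryQuadraticProofs
import HarnessLib

/-!
# Sketch sidea k2 g34 — `stub_cmLambdaLower` (skeleton `Lines/bt26_lambda.lean` v8, crux
# `ResidualThetaCountLowerPureAtTwo`, stmt-BirchSwinnertonDyer-26074): the KERNEL HINGE of the
# print-by-proof reading that retires the research debt (ε1) under the conjunct (LAM) of «Kato125AB»

BSD is NOT proved by any of this; items 22608 / 26074 stay OPEN, 24105 HOLD. Nothing here is a
registered byte, a route, a registry verb or a `Theorems/` proposal. Stub-ideation seat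
`sidea-stub_cmLambdaLower-2-g34` (k = 2, gen 34; technique «literature transfer, typed dictionary»).

## What is typed here and why (the dictionary line it serves)

(ε1) = the EQUALITY half of Johnson-Leung–Kings' Λ-main conjecture at `p = 2` (Crelle 653 (2011)
Thm. 5.2 "for all primes p with no exceptions"), consumed by Burungale–Tian, Annals 203 (2026)
Thm. 2.1 ⇒ Thm. 2.6 = the (LAM) conjunct of the merged print fact «Kato125AB» at `p = 2`.  Its two
`p = 2` print leaves are JLK Thm. 2.6 ((TNConj) for `M(F) = h⁰(Spec F)`, `ℤ₂`-coefficients) and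
JLK Prop. 2.9 (lattice compatibility of Artin–Verdier duality over `𝒪_K[1/2]`), both delegated by
JLK to K. Itakura's UNPUBLISHED preprint [It] 3.1 / 1.15 (card k4-g30, H6).  The REFEREED source of
both statements at ODD `p` is Huber–Kings, Duke 119 (2003): Prop. 2.3.1 ("up to powers of 2") and
Prop. 1.2.10 (`p ≠ 2`), and Huber–Kings THEMSELVES localise the `p = 2` defect AT THE REAL PLACE:
"For p = 2 the complex RΓ(ℤ[1/p], T_p^∨(1−r)) is not perfect and one has to consider τ_{≤2}RΓ …
Moreover T_p(r)^+ = H⁰(ℝ, T_p(r)) has to be substituted by the zeroeth Tate-cohomology"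
[arXiv:math/0101071 p.7], and the `r = 1` loss is the factor `2^{r₁}` [ibid. p.12].  The fields JLK
actually feed into their Cor. 2.11 are `L = K_n(𝔣_η)`, `F = K_{n−1}(𝔣_η)` [arXiv:0804.2828 p.20] —
RAY CLASS FIELDS OF THE IMAGINARY QUADRATIC FIELD `K`, hence TOTALLY COMPLEX: no real place, `r₁ = 0`,
no real embedding, `cd₂(G_{F,S}) ≤ 2` (Harari, *Galois cohomology and class field theory*, Cor. 17.14
/ Thm. 18.15: "assumed different from 2 if k has real places").  So Huber–Kings' printed proofs run
verbatim at `p = 2` for these fields.  THIS FILE types the number-field half of that hinge in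
Mathlib's vocabulary (`NumberField.IsTotallyComplex`, `nrRealPlaces`, `ComplexEmbedding.IsReal`) over
the tree's `IsImaginaryQuadratic` — five kernel lemmas, no `sorry`:

* `isTotallyComplex_of_isImaginaryQuadratic` : `K` imaginary quadratic, `L` a field over `K` ⇒ `L`
  totally complex (HK1's "T_p^+ vs Tate cohomology" caveat and JLK's "Ĥ⁰(ℝ, ·) = 0" are about REAL
  places — `L` has none);
* `nrRealPlaces_eq_zero_of_isImaginaryQuadratic` : `r₁(L) = 0`;
* `two_pow_nrRealPlaces_eq_one` : HK1's `r = 1` loss factor `2^{r₁(L)} = 1`;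
* `not_isReal_complexEmbedding` : no embedding `L →+* ℂ` is real;
* `isEmpty_realPlaces` : the index type of real places of `L` is EMPTY (every "⊕ over real places"
  correction term in the `p = 2` Tamagawa-number bookkeeping is an empty sum / empty product).

The Galois-cohomological half of the hinge (`cd₂ ≤ 2`) is a CITATION (Harari Cor. 17.14), not typed:
the tree has no `G_{F,S}`-cohomological-dimension API and none is proposed here.
-/

namespace Summit.BirchSwinnertonDyer.BirchSwinnertonDyer.Cruxes.ResidualThetaCountLowerPureAtTwo.SideaK2G34

open NumberField NumberField.InfinitePlace
open Literature.NumberTheory.EllipticCurves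

universe u v

variable {K : Type u} [Field K] [NumberField K] {L : Type v} [Field L] [Algebra K L]

/-- HINGE (H1). A number field `L` containing an imaginary quadratic field `K` is totally complex:
every infinite place of `L` is complex (a real place of `L` would restrict to a real place of `K`).
This is the number-field content of JLK's remark in the proof of Prop. 2.9 at `p = 2` and the reason
Huber–Kings' `p ≠ 2` caveat (Prop. 1.2.10: real-place Tate cohomology) is void over `K`. [folklore] -/
theorem isTotallyComplex_of_isImaginaryQuadratic (hK : IsImaginaryQuadratic K) :
    IsTotallyComplex L := by
  haveI : IsTotallyComplex K := hK.2
  exact isTotallyComplex_of_algebra K L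

/-- HINGE (H2). `r₁(L) = 0` for every number field `L` over an imaginary quadratic `K`. [folklore] -/
theorem nrRealPlaces_eq_zero_of_isImaginaryQuadratic [NumberField L] (hK : IsImaginaryQuadratic K) :
    nrRealPlaces L = 0 := by
  haveI : IsTotallyComplex L := isTotallyComplex_of_isImaginaryQuadratic (L := L) hK
  exact IsTotallyComplex.nrRealPlaces_eq_zero L

/-- HINGE (H3). Huber–Kings' `r = 1` loss factor `2^{r₁}` (Duke 119 (2003), proof of Prop. 2.3.1,
"Hence, (up to powers of 2) …", the discrepancy `d^{1/2}/2^{r₁}(2π)^{r₂}`) equals `1` for the fields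
JLK use. [folklore] -/
theorem two_pow_nrRealPlaces_eq_one [NumberField L] (hK : IsImaginaryQuadratic K) :
    (2 : ℕ) ^ nrRealPlaces L = 1 := by
  rw [nrRealPlaces_eq_zero_of_isImaginaryQuadratic (L := L) hK, pow_zero]

/-- HINGE (H4). No complex embedding of `L` is real: the real-place terms `H⁰(ℝ, T)` / `Ĥ⁰(ℝ, T)`
that distinguish `p = 2` in Huber–Kings Prop. 1.2.10 do not occur for `L`. [folklore] -/
theorem not_isReal_complexEmbedding (hK : IsImaginaryQuadratic K) (φ : L →+* ℂ) :
    ¬ ComplexEmbedding.IsReal φ := by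
  haveI : IsTotallyComplex L := isTotallyComplex_of_isImaginaryQuadratic (L := L) hK
  exact IsTotallyComplex.complexEmbedding_not_isReal φ

/-- HINGE (H5). The type of real places of `L` is empty — every correction term indexed by the real
places (in the `p = 2` Tamagawa-number / Artin–Verdier bookkeeping) is an empty product. [folklore] -/
theorem isEmpty_realPlaces (hK : IsImaginaryQuadratic K) :
    IsEmpty {w : InfinitePlace L // w.IsReal} := by
  haveI : IsTotallyComplex L := isTotallyComplex_of_isImaginaryQuadratic (L := L) hK
  refine ⟨fun w => ?_⟩
  exact (not_isReal_iff_isComplex.mpr (IsTotallyComplex.isComplex w.1)) w.2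

open scoped Classical in
/-- (H5′) the same as a `Finset`-level statement: a sum over the real places of `L` of any
`ℕ`-valued correction term vanishes. [folklore] -/
theorem sum_realPlaces_eq_zero [NumberField L] (hK : IsImaginaryQuadratic K) (c : InfinitePlace L → ℕ) :
    (Finset.univ.filter (fun w : InfinitePlace L => w.IsReal)).sum c = 0 := by
  haveI : IsTotallyComplex L := isTotallyComplex_of_isImaginaryQuadratic (L := L) hK
  refine Finset.sum_eq_zero ?_
  intro w hw
  exact absurd (Finset.mem_filter.mp hw).2 (not_isReal_iff_isComplex.mpr (IsTotallyComplex.isComplex w))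

/-- Sanity instance of the hinge at the base: `K` itself (take `L = K`). -/
example (hK : IsImaginaryQuadratic K) : nrRealPlaces K = 0 :=
  nrRealPlaces_eq_zero_of_isImaginaryQuadratic (L := K) hK

end Summit.BirchSwinnertonDyer.BirchSwinnertonDyer.Cruxes.ResidualThetaCountLowerPureAtTwo.SideaK2G34
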